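import Literature.Computability.Complexity.AverageCaseDepthHierarchyChernoff
import Literature.Computability.Complexity.AverageCaseDepthHierarchyProcess
import HarnessLib

/-!
# Probabilities of the branches of an RST block, and events of independent blocks

B. Rossman, R. A. Servedio, L.-Y. Tan, *An average-case depth hierarchy theorem for Boolean
circuits*, arXiv:1504.03398 [RossmanServedioTan2015], §7.2 Def. 9 (p. 18: the three branches of
`R(τ)` on a block have probabilities `λ`, `q_a`, `1 - λ - q_a`), §10.1 Lemma 15 (p. 33–34: hence
the lifted value `ρ̂_{a,i}` is `•` w.p. `λ`, `⋆` w.p. `q_{a,i}`, `∘` otherwise, independently) and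
the elementary probability used throughout §10.1 (marginals, union bounds and product events for
independent blocks).

* `BlockLaw.weight_lift_none` / `weight_allo'` / `weight_lift_bullet` — for a block in case 2 the
  lifted value is `⋆` with probability exactly `q_a`, the all-`∘` refinement has probability `λ`,
  and a bullet appears with probability `1 - λ - q_a`; `weight_lift_ne_bullet_of_bullet` — a block
  of `τ` that already has a bullet keeps it.
* `weight_marginal`, `weight_forall_eq_prod`, `weight_exists_le_sum` — marginal, product event and
  union bound for a product weight `∏_a ζ_a(ρ_a)` (and `…_groups` versions for events attached to
  the disjoint groups `{(g,i)}_i` of `G × I`-indexed blocks).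

All statements are finite sums; constants are exact.
-/

noncomputable section

namespace Literature.Computability.Complexity

namespace RSTProj

open Finset

/-! ### Union bounds for weighted sums -/

section UnionBound

variable {Ω : Type*} [Fintype Ω]

/-- **Union bound**: the weight of a finite union of events is at most the sum of the weights. [folklore] -/
theorem weight_exists_le {κ : Type*} (μ : Ω → ℝ) (hμ : ∀ x, 0 ≤ μ x) (G : Finset κ) (B : κ → Ω → Prop)
    [∀ k x, Decidable (B k x)] :
    ∑ x ∈ univ.filter (fun x => ∃ k ∈ G, B k x), μ x ≤ ∑ k ∈ G, ∑ x ∈ univ.filter (fun x => B k x), μ x := by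
  classical
  induction G using Finset.induction_on with
  | empty => simp
  | insert k G hk ih =>
    rw [Finset.sum_insert hk]
    have hsplit : univ.filter (fun x => ∃ k' ∈ insert k G, B k' x) ⊆
        univ.filter (fun x => B k x) ∪ univ.filter (fun x => ∃ k' ∈ G, B k' x) := by
      intro x hx
      simp only [Finset.mem_filter, Finset.mem_univ, true_and, Finset.mem_insert] at hx
      obtain ⟨k', hk', hB⟩ := hx
      rw [Finset.mem_union, Finset.mem_filter, Finset.mem_filter]
      rcases hk' with rfl | hk'
      · exact Or.inl ⟨Finset.mem_univ _, hB⟩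
      · exact Or.inr ⟨Finset.mem_univ _, k', hk', hB⟩
    calc ∑ x ∈ univ.filter (fun x => ∃ k' ∈ insert k G, B k' x), μ x
        ≤ ∑ x ∈ univ.filter (fun x => B k x) ∪ univ.filter (fun x => ∃ k' ∈ G, B k' x), μ x :=
          Finset.sum_le_sum_of_subset_of_nonneg hsplit fun x _ _ => hμ x
      _ ≤ ∑ x ∈ univ.filter (fun x => B k x), μ x + ∑ x ∈ univ.filter (fun x => ∃ k' ∈ G, B k' x), μ x := by
          rw [← Finset.sum_union_inter]
          have : 0 ≤ ∑ x ∈ univ.filter (fun x => B k x) ∩ univ.filter (fun x => ∃ k' ∈ G, B k' x), μ x :=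
            Finset.sum_nonneg fun x _ => hμ x
          linarith
      _ ≤ _ := add_le_add le_rfl ih

end UnionBound

/-! ### Events of independent blocks under a product weight -/

section ProductWeight

variable {A X : Type*} [Fintype A] [DecidableEq A] [Fintype X]

/-- **Product events**: `P[∀ b ∈ B, f_b] = ∏_{b∈B} P_b[f_b]` under a product weight with unit
block masses. [cite: RossmanServedioTan2015, §10.1 Lemma 15 (p. 34, "independently for all `a`")] -/
theorem weight_forall_eq_prod (ζ : A → X → ℝ) (hζ1 : ∀ a, ∑ x, ζ a x = 1) (B : Finset A)
    (f : A → X → Prop) [∀ a x, Decidable (f a x)] :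
    ∑ ρ : A → X, (∏ a, ζ a (ρ a)) * (if (∀ b ∈ B, f b (ρ b)) then 1 else 0) =
      ∏ b ∈ B, ∑ x ∈ univ.filter (fun x => f b x), ζ b x := by
  classical
  have hind : ∀ ρ : A → X, (if (∀ b ∈ B, f b (ρ b)) then (1 : ℝ) else 0) =
      ∏ a, (if a ∈ B then (if f a (ρ a) then 1 else 0) else 1) := by
    intro ρ
    rw [Finset.prod_ite_mem, Finset.univ_inter]
    by_cases h : ∀ b ∈ B, f b (ρ b)
    · rw [if_pos h]; exact (Finset.prod_eq_one fun b hb => if_pos (h b hb)).symm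
    · rw [if_neg h]; push Not at h
      obtain ⟨b, hb, hfb⟩ := h
      exact (Finset.prod_eq_zero hb (if_neg hfb)).symm
  have h := Finset.prod_univ_sum (fun (_ : A) => (univ : Finset X))
    (fun a x => ζ a x * (if a ∈ B then (if f a x then 1 else 0) else 1))
  simp only [Fintype.piFinset_univ] at h
  have e : ∀ ρ : A → X, (∏ a, ζ a (ρ a)) * (if (∀ b ∈ B, f b (ρ b)) then 1 else 0) =
      ∏ a, (ζ a (ρ a) * (if a ∈ B then (if f a (ρ a) then 1 else 0) else 1)) := by
    intro ρ; rw [hind, ← Finset.prod_mul_distrib]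
  rw [Finset.sum_congr rfl fun ρ _ => e ρ, ← h, ← Finset.prod_filter_mul_prod_filter_not univ (fun a => a ∈ B)]
  have eB : univ.filter (fun a => a ∈ B) = B := by ext a; simp
  have hin : ∏ a ∈ univ.filter (fun a => a ∈ B), ∑ x, ζ a x * (if a ∈ B then (if f a x then 1 else 0) else 1) =
      ∏ b ∈ B, ∑ x ∈ univ.filter (fun x => f b x), ζ b x := by
    rw [eB]
    refine Finset.prod_congr rfl fun b hb => ?_
    simp only [if_pos hb, mul_ite, mul_one, mul_zero]
    rw [Finset.sum_filter]
  have hout : ∏ a ∈ univ.filter (fun a => ¬ a ∈ B), ∑ x, ζ a x * (if a ∈ B then (if f a x then 1 else 0) else 1) = 1 :=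
    Finset.prod_eq_one fun a ha => by
      simp only [if_neg (Finset.mem_filter.1 ha).2, mul_one]; exact hζ1 a
  rw [hin, hout, mul_one]

/-- **Marginals**: `P[f(ρ_b)] = P_b[f]`. [folklore] -/
theorem weight_marginal (ζ : A → X → ℝ) (hζ1 : ∀ a, ∑ x, ζ a x = 1) (b : A) (f : X → Prop) [DecidablePred f] :
    ∑ ρ ∈ univ.filter (fun ρ : A → X => f (ρ b)), (∏ a, ζ a (ρ a)) = ∑ x ∈ univ.filter (fun x => f x), ζ b x := by
  classical
  have h := weight_forall_eq_prod ζ hζ1 {b} (fun _ x => f x)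
  rw [Finset.prod_singleton] at h
  rw [← h, Finset.sum_filter]
  refine Finset.sum_congr rfl fun ρ _ => ?_
  by_cases hf : f (ρ b) <;> simp [hf]

/-- **Union bound over blocks**: `P[∃ b ∈ B, f_b(ρ_b)] ≤ Σ_{b∈B} P_b[f_b]`. [cite: RossmanServedioTan2015, §10.1 (p. 32, "a union bound over all `a`")] -/
theorem weight_exists_le_sum (ζ : A → X → ℝ) (hζ0 : ∀ a x, 0 ≤ ζ a x) (hζ1 : ∀ a, ∑ x, ζ a x = 1) (B : Finset A)
    (f : A → X → Prop) [∀ a x, Decidable (f a x)] :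
    ∑ ρ ∈ univ.filter (fun ρ : A → X => ∃ b ∈ B, f b (ρ b)), (∏ a, ζ a (ρ a)) ≤
      ∑ b ∈ B, ∑ x ∈ univ.filter (fun x => f b x), ζ b x := by
  classical
  refine (weight_exists_le (fun ρ : A → X => ∏ a, ζ a (ρ a)) (fun ρ => Finset.prod_nonneg fun a _ => hζ0 _ _) B
    (fun b ρ => f b (ρ b))).trans ?_
  exact Finset.sum_le_sum fun b _ => le_of_eq (weight_marginal ζ hζ1 b (f b))

/-- The weight of a group of blocks is a probability mass function. [folklore] -/
theorem sum_groupWeight {G I : Type*} [Fintype I] [DecidableEq I] (ζ : G × I → X → ℝ) (hζ1 : ∀ a, ∑ x, ζ a x = 1) (g : G) :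
    ∑ xs : I → X, ∏ i, ζ (g, i) (xs i) = 1 := by
  classical
  have h := Finset.prod_univ_sum (fun (_ : I) => (univ : Finset X)) (fun i x => ζ (g, i) x)
  simp only [Fintype.piFinset_univ] at h
  rw [← h]; exact Finset.prod_eq_one fun i _ => hζ1 (g, i)

/-- **Union bound over disjoint groups of blocks.** [cite: RossmanServedioTan2015, §10.1 Lemma 16 (p. 34)] -/
theorem weight_exists_le_sum_groups {G I : Type*} [Fintype G] [DecidableEq G] [Fintype I] [DecidableEq I]
    (ζ : G × I → X → ℝ) (hζ0 : ∀ a x, 0 ≤ ζ a x) (hζ1 : ∀ a, ∑ x, ζ a x = 1) (B : Finset G)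
    (f : G → (I → X) → Prop) [∀ g xs, Decidable (f g xs)] :
    ∑ ρ ∈ univ.filter (fun ρ : G × I → X => ∃ g ∈ B, f g (fun i => ρ (g, i))), (∏ a, ζ a (ρ a)) ≤
      ∑ g ∈ B, ∑ xs ∈ univ.filter (fun xs : I → X => f g xs), ∏ i, ζ (g, i) (xs i) := by
  classical
  have key := weight_exists_le_sum (A := G) (X := I → X) (fun g xs => ∏ i, ζ (g, i) (xs i))
    (fun g xs => Finset.prod_nonneg fun i _ => hζ0 _ _) (sum_groupWeight ζ hζ1) B f
  refine le_trans (le_of_eq ?_) key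
  rw [Finset.sum_filter, Finset.sum_filter, ← (Equiv.curry G I X).symm.sum_comp]
  refine Finset.sum_congr rfl fun ρc _ => ?_
  have e1 : (∏ a, ζ a ((Equiv.curry G I X).symm ρc a)) = ∏ g, ∏ i, ζ (g, i) (ρc g i) := by
    rw [Fintype.prod_prod_type]; rfl
  rw [e1]
  rfl

end ProductWeight

/-! ### The probabilities of the three branches of a block -/

namespace BlockLaw

variable (L : BlockLaw) {w : ℕ}

/-- In case 2 the all-`∘` refinement is the constant-`∘` string. [folklore] -/
theorem allo_eq_const {τa : Fin w → Option Bool} (hc : L.Case2 τa) : L.allo τa = fun _ => some L.o := by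
  funext i
  simp only [allo]
  cases hτ : τa i with
  | none => rfl
  | some b =>
    have hb : b = L.o := by
      by_contra hne
      have : b = !L.o := by cases b <;> cases ho : L.o <;> simp_all
      exact hc.1 i (by rw [hτ, this])
    rw [hb]; rfl

/-- A nonzero `L2`-product weight means: a refinement without bullets (in case 2). [folklore] -/
theorem refines_nobullet_of_prodW_L2_ne_zero {τa ϱ : Fin w → Option Bool} (hc : L.Case2 τa)
    (h : prodW τa L.L2 ϱ ≠ 0) : Refines ϱ τa ∧ ∀ i, ϱ i ≠ some (!L.o) := by
  have href : Refines ϱ τa := by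
    by_contra hn; exact h (prodW_eq_zero_of_not_refines hn _)
  refine ⟨href, fun i hb => ?_⟩
  cases hτ : τa i with
  | none => exact h (prodW_eq_zero_of_letter (Lf := L.L2) hτ (by rw [hb]; simp [L2]))
  | some c =>
    have := href i (by rw [hτ]; exact Option.some_ne_none c)
    rw [hb, hτ] at this
    exact hc.1 i (by rw [hτ]; exact this.symm)

/-- The lifted value of a string with a star and no bullet is `⋆`; of a total string it is determined. [folklore] -/
theorem liftBlock_eq_none_iff {ϱ : Fin w → Option Bool} (hnb : ∀ i, ϱ i ≠ some (!L.o)) :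
    liftBlock L.o ϱ = none ↔ ∃ i, ϱ i = none := by
  unfold liftBlock
  rw [if_neg (fun ⟨i, hi⟩ => hnb i hi)]
  constructor
  · intro h
    by_contra hne
    push Not at hne
    have hall : ∀ i, ϱ i = some L.o := by
      intro i
      cases hϱ : ϱ i with
      | none => exact absurd hϱ (hne i)
      | some b =>
        have : b ≠ !L.o := fun hb => hnb i (by rw [hϱ, hb])
        cases b <;> cases ho : L.o <;> simp_all
    rw [if_pos hall] at h
    exact (Option.some_ne_none _) h
  · rintro ⟨i, hi⟩
    rw [if_neg]
    intro hall; rw [hall i] at hi; exact (Option.some_ne_none _) hi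

/-- **Branch 2 has probability `q_a`**: in case 2 the lifted value is `⋆` (equivalently, a star
survives) with probability exactly `q_a = ((1-t)^{|S_a|} - λ)/t'`. [cite: RossmanServedioTan2015, §10.1 Lemma 15 (p. 34, "`⋆` with probability `q_{a,i}`") and §7.2 Def. 9 (p. 18)] -/
theorem weight_lift_none (ht0 : 0 < L.t) (ht1 : L.t ≤ 1) {τa : Fin w → Option Bool} (hc : L.Case2 τa) :
    ∑ ϱ ∈ univ.filter (fun ϱ : Fin w → Option Bool => liftBlock L.o ϱ = none), L.ζ τa ϱ = L.qa (stars τa).card := by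
  classical
  set n := (stars τa).card with hn
  have hD : (1 : ℝ) - (1 - L.t) ^ n ≠ 0 := by
    have : (1 - L.t) ^ n < 1 := pow_lt_one₀ (by linarith) (by linarith) hc.2.2
    linarith
  have key : ∀ ϱ : Fin w → Option Bool, (if liftBlock L.o ϱ = none then L.ζ τa ϱ else 0) =
      L.qa n / (1 - (1 - L.t) ^ n) * (prodW τa L.L2 ϱ - (1 - L.t) ^ n * L.ind τa ϱ) := by
    intro ϱ
    by_cases hal : ϱ = L.allo τa
    · -- the all-`∘` string: lifted value `∘`, weight `λ`, right side `0`
      rw [hal, L.prodW_L2_allo, ← hn, if_neg]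
      · simp [ind]
      · rw [L.allo_eq_const hc]; unfold liftBlock
        rw [if_neg, if_pos (fun _ => rfl)]
        · exact Option.some_ne_none _
        · rintro ⟨i, hi⟩; exact Bool.not_ne_self L.o (Option.some.inj hi).symm
    rw [L.ind_of_ne hal, mul_zero, sub_zero]
    by_cases h2 : prodW τa L.L2 ϱ = 0
    · rw [h2, mul_zero]
      split_ifs with hl
      · -- a surviving star with zero `L2` weight: the law gives it weight `0`
        by_cases hstar : ∃ i, ϱ i = none
        · obtain ⟨i, hi⟩ := hstar
          rw [L.ζ_of_star hc hi, h2, mul_zero]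
        · -- no star and not determined: impossible for a total string
          exfalso
          push Not at hstar
          unfold liftBlock at hl
          split_ifs at hl with h1 h2'
          apply h2'
          intro i
          cases hϱ : ϱ i with
          | none => exact absurd hϱ (hstar i)
          | some b =>
            have : b ≠ !L.o := fun hb => h1 ⟨i, by rw [hϱ, hb]⟩
            cases b <;> cases ho : L.o <;> simp_all
      · rfl
    · obtain ⟨href, hnb⟩ := L.refines_nobullet_of_prodW_L2_ne_zero hc h2
      have hstar : ∃ i, ϱ i = none := by
        by_contra hno
        push Not at hno
        apply hal
        funext i
        rw [L.allo_eq_const hc]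
        cases hϱ : ϱ i with
        | none => exact absurd hϱ (hno i)
        | some b =>
          have : b ≠ !L.o := fun hb => hnb i (by rw [hϱ, hb])
          cases b <;> cases ho : L.o <;> simp_all
      obtain ⟨i, hi⟩ := hstar
      rw [if_pos ((L.liftBlock_eq_none_iff hnb).2 ⟨i, hi⟩), L.ζ_of_star hc hi]
  rw [Finset.sum_filter, Finset.sum_congr rfl fun ϱ _ => key ϱ, ← Finset.mul_sum, Finset.sum_sub_distrib,
    sum_prodW, L.sum_L2, one_pow, ← Finset.mul_sum]
  have hind : ∑ ϱ : Fin w → Option Bool, L.ind τa ϱ = 1 := by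
    simp only [ind]; rw [Finset.sum_ite_eq' univ (L.allo τa) (fun _ => (1 : ℝ))]; simp
  rw [hind, mul_one]
  field_simp

/-- **Branch 1**: in case 2 the lifted value is the controlling value for the parent (the block is
all-`∘`) with probability exactly `λ`. [cite: RossmanServedioTan2015, §10.1 Lemma 15 (p. 34, "`•` with probability `λ`")] -/
theorem weight_lift_circ {τa : Fin w → Option Bool} (hc : L.Case2 τa) :
    ∑ ϱ ∈ univ.filter (fun ϱ : Fin w → Option Bool => liftBlock L.o ϱ = some L.o), L.ζ τa ϱ = L.lam := by
  classical
  have hset : univ.filter (fun ϱ : Fin w → Option Bool => liftBlock L.o ϱ = some L.o) = {L.allo τa} := by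
    ext ϱ
    simp only [Finset.mem_filter, Finset.mem_univ, true_and, Finset.mem_singleton]
    rw [L.allo_eq_const hc]
    unfold liftBlock
    constructor
    · intro h
      split_ifs at h with h1 h2
      · exact absurd (Option.some.inj h) (Bool.not_ne_self L.o)
      · funext i; exact h2 i
    · intro h; subst h
      rw [if_neg, if_pos (fun _ => rfl)]
      rintro ⟨i, hi⟩; exact Bool.not_ne_self L.o (Option.some.inj hi).symm
  rw [hset, Finset.sum_singleton, L.ζ_allo hc]

/-- **Branch 3**: in case 2 a bullet appears (the lifted value is the non-controlling value for the
parent) with probability exactly `1 - λ - q_a`. [cite: RossmanServedioTan2015, §10.1 Lemma 15 (p. 34, "`∘` otherwise, with probability `1-λ-q_{a,i}`")] -/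
theorem weight_lift_bullet (ht0 : 0 < L.t) (ht1 : L.t ≤ 1) {τa : Fin w → Option Bool} (hc : L.Case2 τa) :
    ∑ ϱ ∈ univ.filter (fun ϱ : Fin w → Option Bool => liftBlock L.o ϱ = some (!L.o)), L.ζ τa ϱ =
      1 - L.lam - L.qa (stars τa).card := by
  classical
  have htot := L.sum_ζ ht0 ht1 τa
  -- the three lifted values partition the strings
  have hsplit : ∀ ϱ : Fin w → Option Bool, L.ζ τa ϱ =
      (if liftBlock L.o ϱ = none then L.ζ τa ϱ else 0) + (if liftBlock L.o ϱ = some L.o then L.ζ τa ϱ else 0) +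
        (if liftBlock L.o ϱ = some (!L.o) then L.ζ τa ϱ else 0) := by
    intro ϱ
    rcases hl : liftBlock L.o ϱ with _ | b
    · simp
    · by_cases hb : b = L.o
      · subst hb; simp
      · have : b = !L.o := by cases b <;> cases ho : L.o <;> simp_all
        subst this; simp
  rw [Finset.sum_congr rfl fun ϱ _ => hsplit ϱ, Finset.sum_add_distrib, Finset.sum_add_distrib,
    ← Finset.sum_filter, ← Finset.sum_filter, ← Finset.sum_filter, L.weight_lift_none ht0 ht1 hc,
    L.weight_lift_circ hc] at htot
  linarith

/-- **A bullet of `τ` stays**: on a block whose `τ`-string already has a bullet, every string of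
positive weight has it, so the lifted value is the non-controlling value for the parent. [cite: RossmanServedioTan2015, §7.2 Def. 9 (p. 18, first bullet) and Remark 4 (p. 18)] -/
theorem weight_lift_ne_bullet_of_bullet {τa : Fin w → Option Bool} (hb : ∃ i, τa i = some (!L.o)) :
    ∑ ϱ ∈ univ.filter (fun ϱ : Fin w → Option Bool => liftBlock L.o ϱ ≠ some (!L.o)), L.ζ τa ϱ = 0 := by
  classical
  refine Finset.sum_eq_zero fun ϱ hϱ => ?_
  by_contra hne
  have href := L.refines_of_ζ_ne_zero hne
  obtain ⟨i, hi⟩ := hb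
  have : ϱ i = some (!L.o) := by rw [href i (by rw [hi]; exact Option.some_ne_none _), hi]
  apply (Finset.mem_filter.1 hϱ).2
  unfold liftBlock; rw [if_pos ⟨i, this⟩]

end BlockLaw

end RSTProj

end Literature.Computability.Complexity

end
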